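import Literature.MathematicalPhysics.QuantumFieldTheory.Balaban1983to89.B13UrsellKP
import Literature.MathematicalPhysics.QuantumFieldTheory.Balaban1983to89.B13Resummation

/-!
# `Balaban1983to89.B13UrsellKPSeries` — T. Bałaban, *Renormalization group approach to lattice gauge field theories.
II. Cluster expansions*, Commun. Math. Phys. **116** (1988) 1–22 [Balaban1988RG2Cluster]: the printed Ursell series
(2.12)/(2.13) p. 14 SUMMED = the tree's Kotecký–Preiss objects (`polymerLogZ`, `truncatedWeight`, `B13Resummation.locE`),
PROVED under absolute convergence

statement-level skeleton of published theorems with citation tags; proofs where landed; nothing here is a claim about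
the Yang–Mills mass gap

PDF held: `paper:balaban1988-cmp116-rg-ii-cluster` (journal page = PDF page + 0); pp. 14, 20–21 read this session.

CITATION HEADER / WHAT IS REPRODUCED (cell `lit-balaban`, Phase-2 proof seat p24, SKELETON row **B13.Def2.12** — *"Mayer
identity (printed ρ^T-series = KP truncated weights termwise) — absent"* — and its companion B13.Def2.13; HOME
`run/shared/lean/pub/lit-balaban/lit-balaban-p24/`).  p. 14, verbatim: *"If the activities H(Z) of the above polymer
expansion are sufficiently small, then the polymer expansion can be exponentiated according to the well-known formula,
see [36, 60, 26, 25, 67, 50]. We obtain by (I.2.13), (1.41), (2.11)* `𝐄^{(k+1)} = Σ_{n=1}^∞ (1/n!) Σ_{(Z₁,…,Z_n)}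
ρ^T(Z₁,…,Z_n) H(Z₁)⋯H(Z_n),` (2.12) … *The representation (I.1.7) for 𝐄^{(k+1)} is constructed by taking*
`𝐄^{(k+1)}(X) = Σ_{n=1}^∞ (1/n!) Σ_{(Z₁,…,Z_n): ∪Z_i = X} ρ^T(Z₁,…,Z_n) H(Z₁)⋯H(Z_n),` (2.13) *where X ∈ 𝐃_{k+1}."*;
p. 20: *"The above lemma implies that sufficient conditions for convergence of the series (2.12), (2.13) are satisfied,
see [26, 67, 25, 50]."*  The printed series are r10's `B13MayerDecoupling.ursellSeries212` / `ursellSeries213` (formal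
`tsum`s); the tree's KERNEL route to the same quantities is the Kotecký–Preiss form — `log Ξ` =
`Literature.Probability.LatticeModels.polymerLogZ` (the branch `∫₀¹ Ξ′(tH)/Ξ(tH) dt`), the truncated weights `Φ^T(C)` =
`truncatedWeight` ([KP86, (3)]) and `𝐄^{(k+1)}(X)` = `B13Resummation.locE ι cubes H X = Σ_{C: ∪_{Z∈C} cubes Z = X}
Φ^T(C)`.  This file PROVES that the two coincide, for every finite polymer catalogue `P`, every reflexive symmetric
incompatibility `ι` (`ζ = zetaOf ι` the printed hard core; `ζ`-forms `…'` for r10's hypotheses `h01/hsymm/hdiag`), and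
activities for which the relevant part of (2.12) converges ABSOLUTELY WITH A MARGIN `r > 1`
(`Σ_n (1/n!) Σ_{(Z₁..Z_{n+1})} |ρ^T| Π|H(Z_i)| r^n < ∞`, the sequences ranging in the relevant sub-catalogue):
* **`ursellSeries212_eq_polymerLogZ`** — (2.12) summed `=` `polymerLogZ ι H univ`; **`cexp_ursellSeries212`** — `exp`(2.12)
  `=` the first sum of (2.11) (`polymerPartitionFunction`; `compatibleFamilySum_eq_Z`): the *"well-known formula"*.
  Route (§§2–4): (2.11) along the ray `tH` is the polynomial `A(t) = Σ a_n t^n/n!` (`Z_ray_eq_tsum`, from r10's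
  `polymerExpansion_211`), (2.12) along the ray is the power series `U(t)` with termwise derivative `U′`
  (`hasDerivAt_tsum_of_isPreconnected`), the exponential formula `B13UrsellKP.seqTerm_succ` resums to `U′A = A′` (Cauchy
  product), whence `A = e^{U}` on `[0,1]` and `log Ξ = ∫₀¹ A′/A = U(1)`.
* **`polymerLogZ_eq_tsum_ursellTermIn`** — the same for every sub-catalogue `B ⊆ P` (`polymerLogZ_image`);
  **`truncatedWeight_eq_tsum_ursellTermOn`** — THE TERMWISE MAYER IDENTITY: `Φ^T(C) = Σ_{n≥1} (1/n!) Σ_{(Z₁..Z_n):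
  {Z_i} = C} ρ^T(Z₁..Z_n) H(Z₁)⋯H(Z_n)` (Möbius inversion over `B ⊆ C`, `sum_powerset_neg_one_pow_sdiff_indicator`);
  **`ursellSeries213_eq_locE`** — (2.13) as printed `=` `B13Resummation.locE` (regrouping the sequences by their support).
* §6: **`summable_ursellAbsTermIn_of_small`** — an explicit *"sufficiently small"*: `e·|B|·max_B|H|·r < 1` implies the
  margin hypothesis over `B` (tree-graph bound `B13UrsellKP.abs_rhoT_le_pow`, summed: `ursellAbsTermIn_le`, and
  `k^k/k! ≤ e^k`); `ursellSeries212_eq_polymerLogZ_of_small`; the `ζ`-forms `ursellSeries212_eq_polymerLogZ'`,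
  `ursellSeries213_eq_locE'`.
NOT here, deliberately: the paper's own volume-UNIFORM route to convergence (Lemma 3 + [26] = [Cammarota1982] §3) — that is
the kernel certificate `B13Resummation` (KP condition, `norm_locE_le`); this file only identifies the printed objects with
the kernel ones where the printed series converge absolutely.  D-0026: no named fact; every `Prop` is a proved `theorem`;
public `def`s are printed objects (`zetaOf`, `ursellAbsTerm`, `ursellTermIn`, `ursellTermOn`, `ursellAbsTermIn`), private
`def`s are plumbing (the generating functions along the ray, the sub-catalogue embedding).
-/

noncomputable section

namespace Literature.MathematicalPhysics.QuantumFieldTheory.Balaban1983to89.B13UrsellKPSeries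

open Finset
open Literature.MathematicalPhysics.QuantumFieldTheory.Balaban1983to89.B13MayerDecoupling (lines rhoT rhoT_zero
  ursellSeries212 ursellSeries213)
open Literature.MathematicalPhysics.QuantumFieldTheory.Balaban1983to89.B13Sect2Statements (hardCore seqTerm
  polymerSeries211 compatibleFamilySum Compatible polymerExpansion_211 seqTerm_eq_zero_of_card_lt)
open Literature.MathematicalPhysics.QuantumFieldTheory.Balaban1983to89.B13UrsellKP (idxGraph ursellTerm
  ursellTerm_zero seqTerm_succ abs_rhoT_le_pow)
open Literature.Probability.LatticeModels (polymerPartitionFunction polymerRayDeriv polymerLogZ truncatedWeight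
  IsCompatible isCompatible_iff hasDerivAt_polymerPartitionFunction_ray polymerLogZ_image)

variable {P : Type*} (ι : P → P → Prop) [DecidableRel ι]

/-! ## §1. The printed hard core `ζ` of (2.11) from an incompatibility relation -/

/-- The printed two-body function of (2.11) p. 14 — *"ζ(Z, Z′) = 0 if Z ∩ Z′ contains a cube, or a wall of a cube,
and ζ(Z, Z′) = 1 otherwise"* — for an abstract incompatibility relation `ι` (the tree's `B13Resummation` /
`Literature.Probability.LatticeModels` vocabulary: `ι Z Z′` ⟺ `ζ(Z, Z′) = 0`).  The concrete instance over the cube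
windows of `TreeLengthCubeSystem` is `B13Eq210Components.zeta B = zetaOf (TreeLengthCubeSystem.Touch B)` (seat p25; `rfl`,
not imported here); r10's `ζ`-language statements are recovered by `zetaOf_zeroSet`.
[cite: Balaban1988RG2Cluster, (2.11) p.14] -/
def zetaOf : P → P → ℝ := fun Z Z' => if ι Z Z' then 0 else 1

variable {ι}

/-- `ζ ∈ {0, 1}`. [cite: Balaban1988RG2Cluster, (2.11) p.14] -/
theorem zetaOf_01 : ∀ Z Z', zetaOf ι Z Z' = 0 ∨ zetaOf ι Z Z' = 1 := by
  intro Z Z'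
  unfold zetaOf
  split_ifs <;> simp

/-- `ζ(Z, Z′) = 0 ⟺ Z ι Z′`. [cite: Balaban1988RG2Cluster, (2.11) p.14] -/
theorem zetaOf_eq_zero_iff {Z Z' : P} : zetaOf ι Z Z' = 0 ↔ ι Z Z' := by
  unfold zetaOf
  split_ifs with h <;> simp [h]

/-- `ζ` is symmetric when `ι` is. [cite: Balaban1988RG2Cluster, (2.11) p.14] -/
theorem zetaOf_symm [Std.Symm ι] : ∀ Z Z', zetaOf ι Z Z' = zetaOf ι Z' Z := by
  intro Z Z'
  unfold zetaOf
  have h : ι Z Z' ↔ ι Z' Z := ⟨fun h => Std.Symm.symm _ _ h, fun h => Std.Symm.symm _ _ h⟩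
  by_cases hZ : ι Z Z'
  · rw [if_pos hZ, if_pos (h.1 hZ)]
  · rw [if_neg hZ, if_neg (fun h' => hZ (h.2 h'))]

/-- `ζ(Z, Z) = 0` (every polymer is incompatible with itself). [cite: Balaban1988RG2Cluster, (2.11) p.14] -/
theorem zetaOf_diag [Std.Refl ι] : ∀ Z, zetaOf ι Z Z = 0 :=
  fun Z => zetaOf_eq_zero_iff.2 (Std.Refl.refl Z)

/-- The index graph of `ζ` is the pulled-back incompatibility. [cite: Balaban1988RG2Cluster, (2.12) p.14] -/
theorem idxGraph_zetaOf_iff {κ : Type*} (Z : κ → P) (i j : κ) : idxGraph (zetaOf ι) Z i j ↔ ι (Z i) (Z j) :=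
  zetaOf_eq_zero_iff

/-! ## §2. (2.11): the first sum is the tree's partition function; scaling of the order-`n` terms -/

section Finite

variable [Fintype P] [DecidableEq P]

/-- The first sum of (2.11) (`B13Sect2Statements.compatibleFamilySum`) for `ζ = zetaOf ι` is the tree's
`polymerPartitionFunction ι H univ`. [cite: Balaban1988RG2Cluster, (2.11) p.14] -/
theorem compatibleFamilySum_eq_Z (H : P → ℂ) :
    compatibleFamilySum (zetaOf ι) H = polymerPartitionFunction ι H Finset.univ := by
  unfold compatibleFamilySum polymerPartitionFunction
  rw [Finset.sum_filter]
  refine Finset.sum_congr rfl fun F _ => ?_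
  have hiff : Compatible (zetaOf ι) F ↔ IsCompatible ι F := by
    rw [isCompatible_iff]
    refine forall₂_congr fun Z _ => forall₂_congr fun Z' _ => imp_congr_right fun _ => ?_
    rw [← zetaOf_eq_zero_iff (ι := ι)]
    rcases zetaOf_01 (ι := ι) Z Z' with h | h <;> simp [h]
  exact if_congr hiff rfl rfl

omit [DecidableEq P] in
/-- Scaling the activities scales the order-`n` term of (2.11) by `c^n`. [cite: Balaban1988RG2Cluster, (2.11) p.14] -/
theorem seqTerm_smul (ζ : P → P → ℝ) (H : P → ℂ) (c : ℂ) (n : ℕ) :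
    seqTerm ζ (fun γ => c * H γ) n = c ^ n * seqTerm ζ H n := by
  unfold seqTerm
  rw [Finset.mul_sum]
  refine Finset.sum_congr rfl fun Z _ => ?_
  rw [Finset.prod_mul_distrib, Finset.prod_const, Finset.card_univ, Fintype.card_fin]
  ring

omit [DecidableEq P] in
/-- Scaling the activities scales the order-`n` term of (2.12) by `c^n`. [cite: Balaban1988RG2Cluster, (2.12) p.14] -/
theorem ursellTerm_smul (ζ : P → P → ℝ) (H : P → ℂ) (c : ℂ) (n : ℕ) :
    ursellTerm ζ (fun γ => c * H γ) n = c ^ n * ursellTerm ζ H n := by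
  unfold ursellTerm
  rw [Finset.mul_sum]
  refine Finset.sum_congr rfl fun Z _ => ?_
  rw [Finset.prod_mul_distrib, Finset.prod_const, Finset.card_univ, Fintype.card_fin]
  ring

omit [DecidableEq P] in
/-- `a_0 = 1`: the empty sequence contributes the printed `1` of (2.11). [cite: Balaban1988RG2Cluster, (2.11) p.14] -/
theorem seqTerm_zero (ζ : P → P → ℝ) (H : P → ℂ) : seqTerm ζ H 0 = 1 := by
  unfold seqTerm hardCore
  simp [Finset.univ_unique]
  rfl

/-- **(2.11) along the ray `t·H`**: the tree's partition function at the activities `tH(Z)` is the exponential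
generating polynomial `Σ_{n ≤ |P|} (1/n!) a_n t^n` of the order-`n` terms `a_n` of (2.11)
(`polymerExpansion_211` + `seqTerm_smul`; a `tsum` with finitely many non-zero terms).
[cite: Balaban1988RG2Cluster, (2.11) p.14] -/
theorem Z_ray_eq_tsum [Std.Refl ι] [Std.Symm ι] (H : P → ℂ) (t : ℝ) :
    polymerPartitionFunction ι (fun γ => (t : ℂ) * H γ) Finset.univ
      = ∑' n : ℕ, (n.factorial : ℂ)⁻¹ * seqTerm (zetaOf ι) H n * (t : ℂ) ^ n := by
  rw [← compatibleFamilySum_eq_Z, polymerExpansion_211 (zetaOf ι) _ zetaOf_01 zetaOf_symm zetaOf_diag]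
  unfold polymerSeries211
  refine tsum_congr fun n => ?_
  rw [seqTerm_smul]
  ring

end Finite

/-! ## §2′. The *"well-known formula"* as an identity of FORMAL POWER SERIES in a marked activity parameter -/

section Formal

variable [Fintype P]

/-- The exponential generating series `A = Σ_n (a_n/n!) Xⁿ` of the order-`n` terms of (2.11) — (2.11) with the
activities `H ↦ X·H`, as a formal power series in `X`. [cite: Balaban1988RG2Cluster, (2.11) p.14] -/
def egf211 (ζ : P → P → ℝ) (H : P → ℂ) : PowerSeries ℂ :=
  PowerSeries.mk fun n => (n.factorial : ℂ)⁻¹ * seqTerm ζ H n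

/-- The exponential generating series `U = Σ_n (u_n/n!) Xⁿ` of the order-`n` terms of (2.12) — (2.12) with the
activities `H ↦ X·H`, as a formal power series in `X`. [cite: Balaban1988RG2Cluster, (2.12) p.14] -/
def egf212 (ζ : P → P → ℝ) (H : P → ℂ) : PowerSeries ℂ :=
  PowerSeries.mk fun n => (n.factorial : ℂ)⁻¹ * ursellTerm ζ H n

/-- **(2.11) `= exp` (2.12) AS FORMAL POWER SERIES**, in the differential form that characterises the exponential:
`A′ = U′ · A` (with `A(0) = 1`, `U(0) = 0`: `seqTerm_zero`, `B13UrsellKP.ursellTerm_zero`), for every `{0,1}`-valued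
symmetric `ζ` and every finite catalogue — the coefficient identity `B13UrsellKP.seqTerm_succ` in Mathlib's `PowerSeries`
vocabulary; no convergence involved (the printed *"well-known formula"* order by order in `n`).
[cite: Balaban1988RG2Cluster, (2.12) p.14] -/
theorem derivative_egf211 {ζ : P → P → ℝ} (h01 : ∀ Z Z', ζ Z Z' = 0 ∨ ζ Z Z' = 1)
    (hsymm : ∀ Z Z', ζ Z Z' = ζ Z' Z) (H : P → ℂ) :
    PowerSeries.derivative ℂ (egf211 ζ H) = PowerSeries.derivative ℂ (egf212 ζ H) * egf211 ζ H := by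
  ext n
  rw [PowerSeries.coeff_mul]
  simp only [egf211, egf212, PowerSeries.coeff_derivative, PowerSeries.coeff_mk]
  rw [Finset.Nat.sum_antidiagonal_eq_sum_range_succ_mk, seqTerm_succ h01 hsymm H n, Finset.mul_sum,
    Finset.sum_mul]
  refine Finset.sum_congr rfl fun k hk => ?_
  have hkn : k ≤ n := Nat.lt_succ_iff.1 (Finset.mem_range.1 hk)
  rw [Nat.cast_choose ℂ hkn, Nat.factorial_succ, Nat.factorial_succ]
  push_cast
  have hn0 : (n.factorial : ℂ) ≠ 0 := by exact_mod_cast n.factorial_ne_zero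
  have hk0 : (k.factorial : ℂ) ≠ 0 := by exact_mod_cast k.factorial_ne_zero
  have hnk0 : ((n - k).factorial : ℂ) ≠ 0 := by exact_mod_cast (n - k).factorial_ne_zero
  have hn1 : ((n : ℂ) + 1) ≠ 0 := by exact_mod_cast Nat.succ_ne_zero n
  have hk1 : ((k : ℂ) + 1) ≠ 0 := by exact_mod_cast Nat.succ_ne_zero k
  field_simp

/-- `A(0) = 1` and `U(0) = 0` — the normalisations under which `A′ = U′A` means `A = exp U`.
[cite: Balaban1988RG2Cluster, (2.12) p.14] -/
theorem constantCoeff_egf (ζ : P → P → ℝ) (H : P → ℂ) :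
    PowerSeries.constantCoeff (egf211 ζ H) = 1 ∧ PowerSeries.constantCoeff (egf212 ζ H) = 0 := by
  constructor
  · rw [← PowerSeries.coeff_zero_eq_constantCoeff_apply, egf211, PowerSeries.coeff_mk, seqTerm_zero]
    simp
  · rw [← PowerSeries.coeff_zero_eq_constantCoeff_apply, egf212, PowerSeries.coeff_mk, ursellTerm_zero]
    simp

end Formal

/-! ## §3. Absolute terms; the exponential generating functions along the ray and their derivatives -/

section Analytic

variable [Fintype P]

/-- The order-`n` term of (2.12) IN ABSOLUTE VALUE, `Σ_{(Z₁,…,Z_n)} |ρ^T(Z₁,…,Z_n)| |H(Z₁)|⋯|H(Z_n)|` — the quantity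
whose `1/n!`-series is estimated in (2.39) p. 21 (*"Σ_{n=1}^∞ (1/n!) Σ_{(Z₁,…,Z_n)} |ρ^T(Z₁,…,Z_n)| Π_i …"*); absolute
convergence of (2.12) means summability of `ursellAbsTerm n / n!`. [cite: Balaban1988RG2Cluster, (2.12) p.14] -/
def ursellAbsTerm (ζ : P → P → ℝ) (H : P → ℂ) (n : ℕ) : ℝ :=
  ∑ Z : Fin n → P, |rhoT ζ Z| * ∏ i, ‖H (Z i)‖

/-- `ursellAbsTerm ≥ 0`. [cite: Balaban1988RG2Cluster, (2.12) p.14] (elementary API for (2.12)) -/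
theorem ursellAbsTerm_nonneg (ζ : P → P → ℝ) (H : P → ℂ) (n : ℕ) : 0 ≤ ursellAbsTerm ζ H n :=
  Finset.sum_nonneg fun _ _ => mul_nonneg (abs_nonneg _) (Finset.prod_nonneg fun _ _ => norm_nonneg _)

/-- `|u_n| ≤` the absolute term. [cite: Balaban1988RG2Cluster, (2.12) p.14] (elementary API for (2.12)) -/
theorem norm_ursellTerm_le (ζ : P → P → ℝ) (H : P → ℂ) (n : ℕ) : ‖ursellTerm ζ H n‖ ≤ ursellAbsTerm ζ H n := by
  unfold ursellTerm ursellAbsTerm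
  refine (norm_sum_le _ _).trans (Finset.sum_le_sum fun Z _ => ?_)
  rw [norm_mul, Complex.norm_real, Real.norm_eq_abs, Complex.norm_prod]

/-- `U(t) = Σ_n (1/n!) u_n t^n` — (2.12) along the ray `t·H` (plumbing; `U(1)` = (2.12)).
[cite: Balaban1988RG2Cluster, (2.12) p.14] (elementary API for (2.12)) -/
private def Ufun (ζ : P → P → ℝ) (H : P → ℂ) (t : ℝ) : ℂ :=
  ∑' n : ℕ, (n.factorial : ℂ)⁻¹ * ursellTerm ζ H n * (t : ℂ) ^ n

/-- `U′(t) = Σ_n (1/n!) u_{n+1} t^n` (plumbing). [cite: Balaban1988RG2Cluster, (2.12) p.14] (elementary API for (2.12)) -/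
private def Uder (ζ : P → P → ℝ) (H : P → ℂ) (t : ℝ) : ℂ :=
  ∑' n : ℕ, (n.factorial : ℂ)⁻¹ * ursellTerm ζ H (n + 1) * (t : ℂ) ^ n

/-- `A(t) = Σ_n (1/n!) a_n t^n` — (2.11) along the ray (plumbing; a polynomial, `Z_ray_eq_tsum`).
[cite: Balaban1988RG2Cluster, (2.11) p.14] (elementary API for (2.11)) -/
private def Afun (ζ : P → P → ℝ) (H : P → ℂ) (t : ℝ) : ℂ :=
  ∑' n : ℕ, (n.factorial : ℂ)⁻¹ * seqTerm ζ H n * (t : ℂ) ^ n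

/-- `A′(t) = Σ_n (1/n!) a_{n+1} t^n` (plumbing). [cite: Balaban1988RG2Cluster, (2.11) p.14] (elementary API for (2.11)) -/
private def Ader (ζ : P → P → ℝ) (H : P → ℂ) (t : ℝ) : ℂ :=
  ∑' n : ℕ, (n.factorial : ℂ)⁻¹ * seqTerm ζ H (n + 1) * (t : ℂ) ^ n

variable (ζ : P → P → ℝ) (H : P → ℂ)

/-- `U(0) = 0` (`u_0 = 0`). [cite: Balaban1988RG2Cluster, (2.12) p.14] (elementary API for (2.12)) -/
private theorem Ufun_zero : Ufun ζ H 0 = 0 := by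
  unfold Ufun
  rw [tsum_eq_single 0 (fun n hn => by simp [zero_pow hn])]
  simp [ursellTerm_zero]

/-- `U(1)` is (2.12) as printed. [cite: Balaban1988RG2Cluster, (2.12) p.14] (elementary API for (2.12)) -/
private theorem Ufun_one : Ufun ζ H 1 = ursellSeries212 ζ H := by
  rw [B13UrsellKP.ursellSeries212_eq_tsum]
  unfold Ufun
  refine tsum_congr fun n => ?_
  simp

/-- `A(0) = 1` (`a_0 = 1`, the printed leading `1` of (2.11)). [cite: Balaban1988RG2Cluster, (2.11) p.14]
(elementary API for (2.11)) -/
private theorem Afun_zero : Afun ζ H 0 = 1 := by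
  unfold Afun
  rw [tsum_eq_single 0 (fun n hn => by simp [zero_pow hn])]
  simp [seqTerm_zero]

/-- `A` is a polynomial of degree `≤ |P|` (the series (2.11) terminates, `seqTerm_eq_zero_of_card_lt`).
[cite: Balaban1988RG2Cluster, (2.11) p.14] (elementary API for (2.11)) -/
private theorem Afun_eq_sum (hdiag : ∀ Z, ζ Z Z = 0) (t : ℝ) :
    Afun ζ H t = ∑ n ∈ Finset.range (Fintype.card P + 1), (n.factorial : ℂ)⁻¹ * seqTerm ζ H n * (t : ℂ) ^ n := by
  unfold Afun
  refine tsum_eq_sum fun n hn => ?_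
  have hn' : Fintype.card P < n := by
    rw [Finset.mem_range] at hn
    omega
  rw [seqTerm_eq_zero_of_card_lt ζ H hdiag hn']
  simp

/-- `A′` as a finite sum. [cite: Balaban1988RG2Cluster, (2.11) p.14] (elementary API for (2.11)) -/
private theorem Ader_eq_sum (hdiag : ∀ Z, ζ Z Z = 0) (t : ℝ) :
    Ader ζ H t = ∑ n ∈ Finset.range (Fintype.card P + 1), (n.factorial : ℂ)⁻¹ * seqTerm ζ H (n + 1) * (t : ℂ) ^ n := by
  unfold Ader
  refine tsum_eq_sum fun n hn => ?_
  have hn' : Fintype.card P < n + 1 := by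
    rw [Finset.mem_range] at hn
    omega
  rw [seqTerm_eq_zero_of_card_lt ζ H hdiag hn']
  simp

/-- `A′` is the derivative of `A`. [cite: Balaban1988RG2Cluster, (2.11) p.14] (elementary API for (2.11)) -/
private theorem hasDerivAt_Afun (hdiag : ∀ Z, ζ Z Z = 0) (t : ℝ) : HasDerivAt (Afun ζ H) (Ader ζ H t) t := by
  have hfun : Afun ζ H = fun s : ℝ =>
      ∑ n ∈ Finset.range (Fintype.card P + 1), (n.factorial : ℂ)⁻¹ * seqTerm ζ H n * (s : ℂ) ^ n :=
    funext (Afun_eq_sum ζ H hdiag)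
  rw [hfun, Ader_eq_sum ζ H hdiag t]
  have h1 : HasDerivAt
      (fun s : ℝ => ∑ n ∈ Finset.range (Fintype.card P + 1), (n.factorial : ℂ)⁻¹ * seqTerm ζ H n * (s : ℂ) ^ n)
      (∑ n ∈ Finset.range (Fintype.card P + 1),
        (n.factorial : ℂ)⁻¹ * seqTerm ζ H n * ((n : ℂ) * (t : ℂ) ^ (n - 1))) t :=
    HasDerivAt.fun_sum fun n _ => ((hasDerivAt_pow n (t : ℂ)).const_mul _).comp_ofReal
  refine h1.congr_deriv ?_
  rw [Finset.sum_range_succ' (fun n => (n.factorial : ℂ)⁻¹ * seqTerm ζ H n * ((n : ℂ) * (t : ℂ) ^ (n - 1))),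
    Finset.sum_range_succ (fun n => (n.factorial : ℂ)⁻¹ * seqTerm ζ H (n + 1) * (t : ℂ) ^ n),
    seqTerm_eq_zero_of_card_lt ζ H hdiag (Nat.lt_succ_self _)]
  simp only [Nat.cast_zero, zero_mul, mul_zero, add_zero]
  refine Finset.sum_congr rfl fun n _ => ?_
  rw [Nat.add_sub_cancel, Nat.factorial_succ]
  push_cast
  have hne : ((n : ℂ) + 1) ≠ 0 := by exact_mod_cast Nat.succ_ne_zero n
  have hne' : (n.factorial : ℂ) ≠ 0 := by exact_mod_cast Nat.factorial_ne_zero n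
  field_simp

/-- `A` and `A′` are continuous. [cite: Balaban1988RG2Cluster, (2.11) p.14] (elementary API for (2.11)) -/
private theorem continuous_Ader (hdiag : ∀ Z, ζ Z Z = 0) : Continuous (Ader ζ H) := by
  have hfun : Ader ζ H = fun s : ℝ =>
      ∑ n ∈ Finset.range (Fintype.card P + 1), (n.factorial : ℂ)⁻¹ * seqTerm ζ H (n + 1) * (s : ℂ) ^ n :=
    funext (Ader_eq_sum ζ H hdiag)
  rw [hfun]
  exact continuous_finsetSum _ fun n _ => continuous_const.mul (Complex.continuous_ofReal.pow n)

variable {ζ H}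

/-- The terms of `U′(t)` are absolutely summable for `|t| ≤ r` when `Σ (1/n!) |u|_{n+1} r^n < ∞` (plumbing).
[cite: Balaban1988RG2Cluster, (2.12) p.14] (elementary API for (2.12)) -/
private theorem summable_norm_Uder_terms {r : ℝ}
    (hU : Summable fun n => ursellAbsTerm ζ H (n + 1) * r ^ n / n.factorial) {t : ℝ} (ht : |t| ≤ r) :
    Summable fun n => ‖(n.factorial : ℂ)⁻¹ * ursellTerm ζ H (n + 1) * (t : ℂ) ^ n‖ := by
  have hr : 0 ≤ r := (abs_nonneg t).trans ht
  refine Summable.of_nonneg_of_le (fun n => norm_nonneg _) (fun n => ?_) hU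
  rw [norm_mul, norm_mul, norm_inv, Complex.norm_natCast, norm_pow, Complex.norm_real, Real.norm_eq_abs,
    div_eq_mul_inv]
  have h1 : |t| ^ n ≤ r ^ n := pow_le_pow_left₀ (abs_nonneg t) ht n
  have h2 : ‖ursellTerm ζ H (n + 1)‖ ≤ ursellAbsTerm ζ H (n + 1) := norm_ursellTerm_le ζ H (n + 1)
  have h3 : 0 ≤ ursellAbsTerm ζ H (n + 1) := ursellAbsTerm_nonneg ζ H (n + 1)
  calc (n.factorial : ℝ)⁻¹ * ‖ursellTerm ζ H (n + 1)‖ * |t| ^ n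
      ≤ (n.factorial : ℝ)⁻¹ * ursellAbsTerm ζ H (n + 1) * r ^ n := by gcongr
    _ = ursellAbsTerm ζ H (n + 1) * r ^ n * (n.factorial : ℝ)⁻¹ := by ring

/-- The terms of `A(t)` are absolutely summable (finitely many). [cite: Balaban1988RG2Cluster, (2.11) p.14]
(elementary API for (2.11)) -/
private theorem summable_norm_Afun_terms (hdiag : ∀ Z, ζ Z Z = 0) (t : ℝ) :
    Summable fun n => ‖(n.factorial : ℂ)⁻¹ * seqTerm ζ H n * (t : ℂ) ^ n‖ := by
  refine summable_of_ne_finset_zero (s := Finset.range (Fintype.card P + 1)) fun n hn => ?_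
  have hn' : Fintype.card P < n := by
    rw [Finset.mem_range] at hn
    omega
  rw [seqTerm_eq_zero_of_card_lt ζ H hdiag hn']
  simp

/-- **`U` is differentiable with derivative `U′` on `(−r, r)`** — termwise differentiation of the power series (2.12)
along the ray (`hasDerivAt_tsum_of_isPreconnected`). [cite: Balaban1988RG2Cluster, (2.12) p.14] (elementary API for (2.12)) -/
private theorem hasDerivAt_Ufun {r : ℝ} (hr : 0 < r)
    (hU : Summable fun n => ursellAbsTerm ζ H (n + 1) * r ^ n / n.factorial) {t : ℝ} (ht : t ∈ Set.Ioo (-r) r) :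
    HasDerivAt (Ufun ζ H) (Uder ζ H t) t := by
  set g : ℕ → ℝ → ℂ := fun n y => (n.factorial : ℂ)⁻¹ * ursellTerm ζ H n * (y : ℂ) ^ n with hg
  set g' : ℕ → ℝ → ℂ := fun n y => (n.factorial : ℂ)⁻¹ * ursellTerm ζ H n * ((n : ℂ) * (y : ℂ) ^ (n - 1))
    with hg'
  set v : ℕ → ℝ := fun n => ‖ursellTerm ζ H n‖ * n * r ^ (n - 1) / n.factorial with hv
  have hv1 : ∀ n, v (n + 1) = ‖ursellTerm ζ H (n + 1)‖ * r ^ n / n.factorial := by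
    intro n
    simp only [hv, Nat.add_sub_cancel, Nat.factorial_succ, Nat.cast_mul, Nat.cast_add, Nat.cast_one]
    have hne : ((n : ℝ) + 1) ≠ 0 := by positivity
    have hne' : (n.factorial : ℝ) ≠ 0 := by positivity
    field_simp
  have hv_summ : Summable v := by
    refine (summable_nat_add_iff 1).1 ?_
    refine Summable.of_nonneg_of_le (fun n => ?_) (fun n => ?_) hU
    · simp only [hv]
      positivity
    · rw [hv1]
      exact div_le_div_of_nonneg_right
        (mul_le_mul_of_nonneg_right (norm_ursellTerm_le ζ H (n + 1)) (pow_nonneg hr.le n)) (Nat.cast_nonneg _)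
  have hderiv : ∀ n y, y ∈ Set.Ioo (-r) r → HasDerivAt (g n) (g' n y) y := by
    intro n y _
    exact ((hasDerivAt_pow n (y : ℂ)).const_mul ((n.factorial : ℂ)⁻¹ * ursellTerm ζ H n)).comp_ofReal
  have hbound : ∀ n y, y ∈ Set.Ioo (-r) r → ‖g' n y‖ ≤ v n := by
    intro n y hy
    have hy' : ‖(y : ℂ)‖ ≤ r := by
      rw [Complex.norm_real, Real.norm_eq_abs]
      exact (abs_lt.2 hy).le
    simp only [hg', hv, norm_mul, norm_inv, Complex.norm_natCast, norm_pow]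
    rw [div_eq_mul_inv]
    have h1 : ‖(y : ℂ)‖ ^ (n - 1) ≤ r ^ (n - 1) := pow_le_pow_left₀ (norm_nonneg _) hy' _
    calc (n.factorial : ℝ)⁻¹ * ‖ursellTerm ζ H n‖ * ((n : ℝ) * ‖(y : ℂ)‖ ^ (n - 1))
        ≤ (n.factorial : ℝ)⁻¹ * ‖ursellTerm ζ H n‖ * ((n : ℝ) * r ^ (n - 1)) := by gcongr
      _ = ‖ursellTerm ζ H n‖ * n * r ^ (n - 1) * (n.factorial : ℝ)⁻¹ := by ring
  have h0 : (0 : ℝ) ∈ Set.Ioo (-r) r := ⟨by linarith, hr⟩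
  have hg0 : Summable fun n => g n 0 := by
    refine summable_of_ne_finset_zero (s := {0}) fun n hn => ?_
    have hn : n ≠ 0 := by simpa using hn
    simp [hg, zero_pow hn]
  have hmain := hasDerivAt_tsum_of_isPreconnected hv_summ isOpen_Ioo isPreconnected_Ioo hderiv hbound h0 hg0 ht
  have hder_val : ∑' n, g' n t = Uder ζ H t := by
    have hsum : Summable fun n => g' n t := Summable.of_norm_bounded hv_summ (fun n => hbound n t ht)
    rw [hsum.tsum_eq_zero_add]
    have h0' : g' 0 t = 0 := by simp [hg']
    rw [h0', zero_add]
    unfold Uder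
    refine tsum_congr fun n => ?_
    simp only [hg', Nat.add_sub_cancel, Nat.factorial_succ]
    push_cast
    have hne : ((n : ℂ) + 1) ≠ 0 := by exact_mod_cast Nat.succ_ne_zero n
    have hne' : (n.factorial : ℂ) ≠ 0 := by exact_mod_cast Nat.factorial_ne_zero n
    field_simp
  rw [hder_val] at hmain
  exact hmain

/-- **The Cauchy product `U′(t)·A(t) = A′(t)`** — the exponential formula `seqTerm_succ` resummed along the ray
(`|t| ≤ r`). [cite: Balaban1988RG2Cluster, (2.12) p.14] (elementary API for (2.12)) -/
private theorem Uder_mul_Afun (h01 : ∀ Z Z', ζ Z Z' = 0 ∨ ζ Z Z' = 1) (hsymm : ∀ Z Z', ζ Z Z' = ζ Z' Z)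
    (hdiag : ∀ Z, ζ Z Z = 0) {r : ℝ} (hU : Summable fun n => ursellAbsTerm ζ H (n + 1) * r ^ n / n.factorial)
    {t : ℝ} (ht : |t| ≤ r) : Uder ζ H t * Afun ζ H t = Ader ζ H t := by
  unfold Uder Afun Ader
  rw [tsum_mul_tsum_eq_tsum_sum_antidiagonal_of_summable_norm (summable_norm_Uder_terms hU ht)
    (summable_norm_Afun_terms hdiag t)]
  refine tsum_congr fun n => ?_
  rw [Finset.Nat.sum_antidiagonal_eq_sum_range_succ_mk, seqTerm_succ h01 hsymm H n, Finset.mul_sum,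
    Finset.sum_mul]
  refine Finset.sum_congr rfl fun k hk => ?_
  have hkn : k ≤ n := Nat.lt_succ_iff.1 (Finset.mem_range.1 hk)
  have hpow : (t : ℂ) ^ k * (t : ℂ) ^ (n - k) = (t : ℂ) ^ n := by
    rw [← pow_add, Nat.add_sub_cancel' hkn]
  rw [show (k.factorial : ℂ)⁻¹ * ursellTerm ζ H (k + 1) * (t : ℂ) ^ k
        * (((n - k).factorial : ℂ)⁻¹ * seqTerm ζ H (n - k) * (t : ℂ) ^ (n - k))
      = ((k.factorial : ℂ)⁻¹ * ((n - k).factorial : ℂ)⁻¹) * (ursellTerm ζ H (k + 1) * seqTerm ζ H (n - k))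
        * ((t : ℂ) ^ k * (t : ℂ) ^ (n - k)) by ring, hpow, Nat.cast_choose ℂ hkn]
  have hn0 : (n.factorial : ℂ) ≠ 0 := by exact_mod_cast n.factorial_ne_zero
  have hk0 : (k.factorial : ℂ) ≠ 0 := by exact_mod_cast k.factorial_ne_zero
  have hnk0 : ((n - k).factorial : ℂ) ≠ 0 := by exact_mod_cast (n - k).factorial_ne_zero
  field_simp

/-- **(2.11) `= exp` (2.12) along the ray**: `A(t) = exp U(t)` for `t ∈ [0, 1]` — `A′ = U′A`, `A(0) = 1`, `U(0) = 0`,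
so `A·e^{−U}` has zero derivative and equals `1`. [cite: Balaban1988RG2Cluster, (2.12) p.14] (elementary API for (2.12)) -/
private theorem Afun_eq_exp (h01 : ∀ Z Z', ζ Z Z' = 0 ∨ ζ Z Z' = 1) (hsymm : ∀ Z Z', ζ Z Z' = ζ Z' Z)
    (hdiag : ∀ Z, ζ Z Z = 0) {r : ℝ} (hr : 1 < r)
    (hU : Summable fun n => ursellAbsTerm ζ H (n + 1) * r ^ n / n.factorial) {t : ℝ} (ht : t ∈ Set.Icc (0 : ℝ) 1) :
    Afun ζ H t = Complex.exp (Ufun ζ H t) := by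
  set G : ℝ → ℂ := fun s => Afun ζ H s * Complex.exp (-Ufun ζ H s) with hG
  have hGd : ∀ s ∈ Set.Icc (0 : ℝ) 1, HasDerivAt G 0 s := by
    intro s hs
    have hs' : s ∈ Set.Ioo (-r) r := ⟨by linarith [hs.1], by linarith [hs.2]⟩
    have hs'' : |s| ≤ r := abs_le.2 ⟨by linarith [hs.1], by linarith [hs.2]⟩
    have hA := hasDerivAt_Afun ζ H hdiag s
    have hUd := hasDerivAt_Ufun (by linarith) hU hs'
    have h2 : HasDerivAt G (Ader ζ H s * Complex.exp (-Ufun ζ H s)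
        + Afun ζ H s * (Complex.exp (-Ufun ζ H s) * -Uder ζ H s)) s := hA.mul hUd.neg.cexp
    refine h2.congr_deriv ?_
    rw [← Uder_mul_Afun h01 hsymm hdiag hU hs'']
    ring
  have hconst := constant_of_has_deriv_right_zero (f := G) (a := 0) (b := 1)
    (fun s hs => (hGd s hs).continuousAt.continuousWithinAt)
    (fun s hs => (hGd s (Set.Ico_subset_Icc_self hs)).hasDerivWithinAt)
  have hGt := hconst t ht
  have hG0 : G 0 = 1 := by simp [hG, Afun_zero, Ufun_zero]
  rw [hG0] at hGt
  calc Afun ζ H t = Afun ζ H t * Complex.exp (-Ufun ζ H t) * Complex.exp (Ufun ζ H t) := by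
        rw [mul_assoc, ← Complex.exp_add, neg_add_cancel, Complex.exp_zero, mul_one]
    _ = Complex.exp (Ufun ζ H t) := by
        rw [show Afun ζ H t * Complex.exp (-Ufun ζ H t) = G t from rfl, hGt, one_mul]

/-! ## §4. (2.12) summed = the Kotecký–Preiss logarithm; (2.11) = exp (2.12) -/

variable [DecidableEq P]

/-- **The printed series (2.12), summed, IS the tree's Kotecký–Preiss logarithm `log Ξ`.**  For a finite polymer
catalogue `P`, a reflexive symmetric incompatibility `ι` (`ζ = zetaOf ι` the printed hard core of (2.11)) and activities
`H` for which the series (2.12) converges absolutely with a margin — `Σ_n (1/n!) Σ_{(Z₁..Z_{n+1})} |ρ^T| Π|H(Z_i)| r^n < ∞`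
for some `r > 1` (print p. 14: *"If the activities H(Z) of the above polymer expansion are sufficiently small"*; an
explicit sufficient condition is `summable_ursellAbsTerm_of_small`) —
`Σ_{n=1}^∞ (1/n!) Σ_{(Z₁,…,Z_n)} ρ^T(Z₁,…,Z_n) H(Z₁)⋯H(Z_n) = log Ξ` (`B13MayerDecoupling.ursellSeries212 =
Literature.Probability.LatticeModels.polymerLogZ ι H univ`, the branch of `log` of the polymer partition function (2.11)
along the ray `t·H` used by `B13Resummation`).  Proof: the exponential formula `seqTerm_succ` gives `A′ = U′A` for the
generating functions along the ray, hence `A = e^{U}` (`Afun_eq_exp`), and `log Ξ = ∫₀¹ A′/A = ∫₀¹ U′ = U(1)`.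
[cite: Balaban1988RG2Cluster, (2.12) p.14] -/
theorem ursellSeries212_eq_polymerLogZ [Std.Refl ι] [Std.Symm ι] (H : P → ℂ) {r : ℝ} (hr : 1 < r)
    (hU : Summable fun n => ursellAbsTerm (zetaOf ι) H (n + 1) * r ^ n / n.factorial) :
    ursellSeries212 (zetaOf ι) H = polymerLogZ ι H Finset.univ := by
  have h01 := zetaOf_01 (ι := ι)
  have hsymm := zetaOf_symm (ι := ι)
  have hdiag := zetaOf_diag (ι := ι)
  have hZA : (fun t : ℝ => polymerPartitionFunction ι (fun γ => (t : ℂ) * H γ) Finset.univ) = Afun (zetaOf ι) H :=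
    funext fun t => Z_ray_eq_tsum H t
  have hZ'A : ∀ t, polymerRayDeriv ι H Finset.univ t = Ader (zetaOf ι) H t := fun t => by
    have h1 := hasDerivAt_polymerPartitionFunction_ray (inc := ι) H Finset.univ t
    rw [hZA] at h1
    exact h1.unique (hasDerivAt_Afun (zetaOf ι) H hdiag t)
  have hAne : ∀ t ∈ Set.Icc (0 : ℝ) 1, Afun (zetaOf ι) H t ≠ 0 := fun t ht => by
    rw [Afun_eq_exp h01 hsymm hdiag hr hU ht]
    exact Complex.exp_ne_zero _
  unfold polymerLogZ
  have hintegrand : (fun t : ℝ => polymerRayDeriv ι H Finset.univ t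
      / polymerPartitionFunction ι (fun γ => (t : ℂ) * H γ) Finset.univ)
      = fun t => Ader (zetaOf ι) H t / Afun (zetaOf ι) H t := by
    funext t
    rw [hZ'A, show polymerPartitionFunction ι (fun γ => (t : ℂ) * H γ) Finset.univ = Afun (zetaOf ι) H t
      from congrFun hZA t]
  rw [hintegrand]
  have hderU : ∀ t ∈ Set.uIcc (0 : ℝ) 1,
      HasDerivAt (Ufun (zetaOf ι) H) (Ader (zetaOf ι) H t / Afun (zetaOf ι) H t) t := by
    intro t ht
    rw [Set.uIcc_of_le zero_le_one] at ht
    have ht' : t ∈ Set.Ioo (-r) r := ⟨by linarith [ht.1], by linarith [ht.2]⟩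
    refine (hasDerivAt_Ufun (by linarith) hU ht').congr_deriv ?_
    rw [← Uder_mul_Afun h01 hsymm hdiag hU (abs_le.2 ⟨by linarith [ht.1], by linarith [ht.2]⟩),
      mul_div_cancel_right₀ _ (hAne t ht)]
  have hcont : ContinuousOn (fun t => Ader (zetaOf ι) H t / Afun (zetaOf ι) H t) (Set.uIcc (0 : ℝ) 1) := by
    refine ContinuousOn.div (continuous_Ader (zetaOf ι) H hdiag).continuousOn
      (fun t _ => (hasDerivAt_Afun (zetaOf ι) H hdiag t).continuousAt.continuousWithinAt) fun t ht => ?_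
    rw [Set.uIcc_of_le zero_le_one] at ht
    exact hAne t ht
  rw [intervalIntegral.integral_eq_sub_of_hasDerivAt hderU hcont.intervalIntegrable, Ufun_one, Ufun_zero, sub_zero]

/-- **(2.11) exponentiated is (2.12)** — the literal content of p. 14 *"the polymer expansion can be exponentiated
according to the well-known formula"*: `exp(Σ_{n≥1} (1/n!) Σ ρ^T H(Z₁)⋯H(Z_n)) = Σ_{{Z₁,…,Z_n}} H(Z₁)⋯H(Z_n)` (the tree's
`polymerPartitionFunction`, = `B13Sect2Statements.compatibleFamilySum` by `compatibleFamilySum_eq_Z`), under absolute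
convergence of (2.12) with a margin. [cite: Balaban1988RG2Cluster, (2.12) p.14] -/
theorem cexp_ursellSeries212 [Std.Refl ι] [Std.Symm ι] (H : P → ℂ) {r : ℝ} (hr : 1 < r)
    (hU : Summable fun n => ursellAbsTerm (zetaOf ι) H (n + 1) * r ^ n / n.factorial) :
    Complex.exp (ursellSeries212 (zetaOf ι) H) = polymerPartitionFunction ι H Finset.univ := by
  rw [← Ufun_one, ← Afun_eq_exp zetaOf_01 zetaOf_symm zetaOf_diag hr hU ⟨zero_le_one, le_rfl⟩]
  show Afun (zetaOf ι) H 1 = _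
  rw [Afun, ← Z_ray_eq_tsum H 1]
  simp

end Analytic

/-! ## §5. Sub-catalogues: the termwise identity `Φ^T(C)` = the `C`-supported part of (2.12), and (2.13) = `locE` -/

section Local

variable [Fintype P] [DecidableEq P]

/-- The order-`n` term of (2.12) restricted to the sequences WITH VALUES IN `B` (the series (2.12) of the sub-catalogue
`B`). [cite: Balaban1988RG2Cluster, (2.12) p.14] -/
def ursellTermIn (ζ : P → P → ℝ) (H : P → ℂ) (n : ℕ) (B : Finset P) : ℂ :=
  ∑ Z ∈ (Finset.univ : Finset (Fin n → P)).filter (fun Z => ∀ i, Z i ∈ B), ((rhoT ζ Z : ℝ) : ℂ) * ∏ i, H (Z i)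

/-- The order-`n` term of (2.12) restricted to the sequences whose SET OF MEMBERS is exactly `C` — the `C`-term of
the resummation of (2.12) by supports (for (2.13): the sequences with `∪_i Z_i = X` are those whose support `C` has
`∪_{Z∈C} Z = X`). [cite: Balaban1988RG2Cluster, (2.13) p.14] -/
def ursellTermOn (ζ : P → P → ℝ) (H : P → ℂ) (n : ℕ) (C : Finset P) : ℂ :=
  ∑ Z ∈ (Finset.univ : Finset (Fin n → P)).filter (fun Z => Finset.univ.image Z = C),
    ((rhoT ζ Z : ℝ) : ℂ) * ∏ i, H (Z i)

/-- The absolute order-`n` term over the sequences with values in `B`. [cite: Balaban1988RG2Cluster, (2.12) p.14] -/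
def ursellAbsTermIn (ζ : P → P → ℝ) (H : P → ℂ) (n : ℕ) (B : Finset P) : ℝ :=
  ∑ Z ∈ (Finset.univ : Finset (Fin n → P)).filter (fun Z => ∀ i, Z i ∈ B), |rhoT ζ Z| * ∏ i, ‖H (Z i)‖

/-- `ursellAbsTermIn ≥ 0`. [cite: Balaban1988RG2Cluster, (2.12) p.14] (elementary API for (2.12)) -/
theorem ursellAbsTermIn_nonneg (ζ : P → P → ℝ) (H : P → ℂ) (n : ℕ) (B : Finset P) :
    0 ≤ ursellAbsTermIn ζ H n B :=
  Finset.sum_nonneg fun _ _ => mul_nonneg (abs_nonneg _) (Finset.prod_nonneg fun _ _ => norm_nonneg _)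

/-- monotonicity of the absolute terms in the sub-catalogue. [cite: Balaban1988RG2Cluster, (2.12) p.14]
(elementary API for (2.12)) -/
theorem ursellAbsTermIn_mono (ζ : P → P → ℝ) (H : P → ℂ) (n : ℕ) {B C : Finset P} (hBC : B ⊆ C) :
    ursellAbsTermIn ζ H n B ≤ ursellAbsTermIn ζ H n C := by
  unfold ursellAbsTermIn
  refine Finset.sum_le_sum_of_subset_of_nonneg (fun Z hZ => ?_) fun _ _ _ =>
    mul_nonneg (abs_nonneg _) (Finset.prod_nonneg fun _ _ => norm_nonneg _)
  rw [Finset.mem_filter] at hZ ⊢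
  exact ⟨hZ.1, fun i => hBC (hZ.2 i)⟩

/-- `|ursellTermIn| ≤ ursellAbsTermIn`. [cite: Balaban1988RG2Cluster, (2.12) p.14] (elementary API for (2.12)) -/
theorem norm_ursellTermIn_le (ζ : P → P → ℝ) (H : P → ℂ) (n : ℕ) (B : Finset P) :
    ‖ursellTermIn ζ H n B‖ ≤ ursellAbsTermIn ζ H n B := by
  unfold ursellTermIn ursellAbsTermIn
  refine (norm_sum_le _ _).trans (Finset.sum_le_sum fun Z _ => ?_)
  rw [norm_mul, Complex.norm_real, Real.norm_eq_abs, Complex.norm_prod]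

/-- `|ursellTermOn n C| ≤ ursellAbsTermIn n C`. [cite: Balaban1988RG2Cluster, (2.13) p.14] (elementary API for (2.13)) -/
theorem norm_ursellTermOn_le (ζ : P → P → ℝ) (H : P → ℂ) (n : ℕ) (C : Finset P) :
    ‖ursellTermOn ζ H n C‖ ≤ ursellAbsTermIn ζ H n C := by
  unfold ursellTermOn ursellAbsTermIn
  refine (norm_sum_le _ _).trans ?_
  have hle : ∀ Z ∈ (Finset.univ : Finset (Fin n → P)).filter (fun Z => Finset.univ.image Z = C),
      ‖((rhoT ζ Z : ℝ) : ℂ) * ∏ i, H (Z i)‖ = |rhoT ζ Z| * ∏ i, ‖H (Z i)‖ := fun Z _ => by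
    rw [norm_mul, Complex.norm_real, Real.norm_eq_abs, Complex.norm_prod]
  rw [Finset.sum_congr rfl hle]
  refine Finset.sum_le_sum_of_subset_of_nonneg (fun Z hZ => ?_) fun _ _ _ =>
    mul_nonneg (abs_nonneg _) (Finset.prod_nonneg fun _ _ => norm_nonneg _)
  rw [Finset.mem_filter] at hZ ⊢
  refine ⟨hZ.1, fun i => ?_⟩
  rw [← hZ.2]
  exact Finset.mem_image_of_mem Z (Finset.mem_univ i)

/-- The embedding of the sequences of the sub-catalogue `B` into the sequences of `P` (plumbing).
[cite: Balaban1988RG2Cluster, (2.12) p.14] (elementary API for (2.12)) -/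
private def valComp (B : Finset P) (n : ℕ) : (Fin n → ↥B) ↪ (Fin n → P) :=
  ⟨fun Z i => (Z i).1, fun _ _ h => funext fun i => Subtype.ext (congrFun h i)⟩

/-- its image is the set of sequences with values in `B` (plumbing). [cite: Balaban1988RG2Cluster, (2.12) p.14]
(elementary API for (2.12)) -/
private theorem map_valComp (B : Finset P) (n : ℕ) :
    (Finset.univ : Finset (Fin n → ↥B)).map (valComp B n)
      = (Finset.univ : Finset (Fin n → P)).filter (fun Z => ∀ i, Z i ∈ B) := by
  ext Z
  simp only [Finset.mem_map, Finset.mem_univ, true_and, Finset.mem_filter]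
  constructor
  · rintro ⟨Z', rfl⟩ i
    exact (Z' i).2
  · intro h
    exact ⟨fun i => ⟨Z i, h i⟩, rfl⟩

/-- The incompatibility of the sub-catalogue (plumbing). [cite: Balaban1988RG2Cluster, (2.11) p.14]
(elementary API for (2.11)) -/
private def subRel (ι : P → P → Prop) (B : Finset P) : ↥B → ↥B → Prop := fun a b => ι a.1 b.1

/-- decidability (plumbing). [cite: Balaban1988RG2Cluster, (2.11) p.14] (elementary API for (2.11)) -/
private instance subRel.instDecidableRel (B : Finset P) : DecidableRel (subRel ι B) :=
  fun a b => inferInstanceAs (Decidable (ι a.1 b.1))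

omit [Fintype P] [DecidableEq P] in
/-- `ρ^T` of a sequence of the sub-catalogue is `ρ^T` of the sequence (plumbing: the same formula).
[cite: Balaban1988RG2Cluster, (2.12) p.14] (elementary API for (2.12)) -/
private theorem rhoT_subRel (B : Finset P) {n : ℕ} (Z : Fin n → ↥B) :
    rhoT (zetaOf (subRel ι B)) Z = rhoT (zetaOf ι) (valComp B n Z) := rfl

/-- the order-`n` Ursell term of the sub-catalogue. [cite: Balaban1988RG2Cluster, (2.12) p.14] (elementary API for (2.12)) -/
private theorem ursellTerm_subRel (H : P → ℂ) (B : Finset P) (n : ℕ) :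
    ursellTerm (zetaOf (subRel ι B)) (fun a => H a.1) n = ursellTermIn (zetaOf ι) H n B := by
  unfold ursellTerm ursellTermIn
  rw [← map_valComp, Finset.sum_map]
  rfl

/-- the absolute order-`n` term of the sub-catalogue. [cite: Balaban1988RG2Cluster, (2.12) p.14]
(elementary API for (2.12)) -/
private theorem ursellAbsTerm_subRel (H : P → ℂ) (B : Finset P) (n : ℕ) :
    ursellAbsTerm (zetaOf (subRel ι B)) (fun a => H a.1) n = ursellAbsTermIn (zetaOf ι) H n B := by
  unfold ursellAbsTerm ursellAbsTermIn
  rw [← map_valComp, Finset.sum_map]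
  rfl

/-- **(2.12) FOR A SUB-CATALOGUE `B`**: the Kotecký–Preiss logarithm `log Ξ_B` of the polymers of `B` is the printed
series (2.12) over the sequences with values in `B`, under absolute convergence with a margin
(`ursellSeries212_eq_polymerLogZ` transported along `B ↪ P`, `polymerLogZ_image`). [cite: Balaban1988RG2Cluster, (2.12) p.14] -/
theorem polymerLogZ_eq_tsum_ursellTermIn [Std.Refl ι] [Std.Symm ι] (H : P → ℂ) (B : Finset P) {r : ℝ} (hr : 1 < r)
    (hB : Summable fun n => ursellAbsTermIn (zetaOf ι) H (n + 1) B * r ^ n / n.factorial) :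
    polymerLogZ ι H B = ∑' n : ℕ, (n.factorial : ℂ)⁻¹ * ursellTermIn (zetaOf ι) H n B := by
  haveI : Std.Refl (subRel ι B) := ⟨fun a => Std.Refl.refl (r := ι) a.1⟩
  haveI : Std.Symm (subRel ι B) := ⟨fun a b h => Std.Symm.symm (r := ι) a.1 b.1 h⟩
  have hB' : Summable fun n => ursellAbsTerm (zetaOf (subRel ι B)) (fun a => H a.1) (n + 1) * r ^ n / n.factorial := by
    simpa only [ursellAbsTerm_subRel] using hB
  have hmain := ursellSeries212_eq_polymerLogZ (ι := subRel ι B) (fun a => H a.1) hr hB'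
  have himage : (Finset.univ : Finset ↥B).image Subtype.val = B := by
    rw [Finset.univ_eq_attach, Finset.attach_image_val]
  have htrans := polymerLogZ_image (inc := subRel ι B) (inc' := ι) (w := fun a : ↥B => H a.1) (w' := H)
    (Λ := Finset.univ) (Subtype.val_injective.injOn) (fun a _ b _ => Iff.rfl) (fun a _ => rfl)
  rw [himage] at htrans
  rw [htrans, ← hmain, B13UrsellKP.ursellSeries212_eq_tsum]
  exact tsum_congr fun n => by rw [ursellTerm_subRel]

/-- summability of the `B`-restricted series from the hypothesis with a margin (plumbing).
[cite: Balaban1988RG2Cluster, (2.12) p.14] (elementary API for (2.12)) -/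
private theorem summable_ursellTermIn (ζ : P → P → ℝ) (H : P → ℂ) {B C : Finset P} (hBC : B ⊆ C) {r : ℝ} (hr : 1 < r)
    (hC : Summable fun n => ursellAbsTermIn ζ H (n + 1) C * r ^ n / n.factorial) :
    Summable fun n => (n.factorial : ℂ)⁻¹ * ursellTermIn ζ H n B := by
  refine (summable_nat_add_iff 1).1 (Summable.of_norm_bounded hC fun n => ?_)
  rw [norm_mul, norm_inv, Complex.norm_natCast]
  have h1 : ‖ursellTermIn ζ H (n + 1) B‖ ≤ ursellAbsTermIn ζ H (n + 1) C :=
    (norm_ursellTermIn_le ζ H (n + 1) B).trans (ursellAbsTermIn_mono ζ H (n + 1) hBC)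
  have h2 : ((n + 1).factorial : ℝ)⁻¹ ≤ (n.factorial : ℝ)⁻¹ := by
    refine inv_anti₀ (by positivity) ?_
    exact_mod_cast Nat.factorial_le (Nat.le_succ n)
  have h3 : (1 : ℝ) ≤ r ^ n := one_le_pow₀ hr.le
  have h4 : 0 ≤ ursellAbsTermIn ζ H (n + 1) C := ursellAbsTermIn_nonneg ζ H (n + 1) C
  calc (((n + 1).factorial : ℕ) : ℝ)⁻¹ * ‖ursellTermIn ζ H (n + 1) B‖
      ≤ (n.factorial : ℝ)⁻¹ * (ursellAbsTermIn ζ H (n + 1) C * r ^ n) := by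
        refine mul_le_mul h2 ?_ (norm_nonneg _) (by positivity)
        calc ‖ursellTermIn ζ H (n + 1) B‖ ≤ ursellAbsTermIn ζ H (n + 1) C * 1 := by rw [mul_one]; exact h1
          _ ≤ ursellAbsTermIn ζ H (n + 1) C * r ^ n := by gcongr
    _ = ursellAbsTermIn ζ H (n + 1) C * r ^ n / n.factorial := by ring

/-- Inclusion–exclusion on the Boolean lattice: `Σ_{R ⊆ B ⊆ C} (−1)^{|C∖B|} = [R = C]` (plumbing for the Möbius
transform (3) of [KP86]). [cite: Balaban1988RG2Cluster, (2.13) p.14] (elementary API for (2.13)) -/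
private theorem sum_powerset_neg_one_pow_sdiff_indicator (R C : Finset P) :
    ∑ B ∈ C.powerset, (-1 : ℂ) ^ (C \ B).card * (if R ⊆ B then 1 else 0) = if R = C then 1 else 0 := by
  by_cases hRC : R ⊆ C
  · have hstep : ∑ B ∈ C.powerset, (-1 : ℂ) ^ (C \ B).card * (if R ⊆ B then 1 else 0)
        = ∑ T ∈ (C \ R).powerset, (-1 : ℂ) ^ T.card := by
      rw [← Finset.sum_filter_add_sum_filter_not C.powerset (fun B => R ⊆ B)]
      rw [Finset.sum_eq_zero (s := C.powerset.filter fun B => ¬ R ⊆ B)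
        (fun B hB => by rw [if_neg (Finset.mem_filter.1 hB).2, mul_zero]), add_zero]
      refine Finset.sum_nbij' (fun B => C \ B) (fun T => C \ T) ?_ ?_ ?_ ?_ ?_
      · intro B hB
        rw [Finset.mem_filter, Finset.mem_powerset] at hB
        exact Finset.mem_powerset.2 (Finset.sdiff_subset_sdiff le_rfl hB.2)
      · intro T hT
        rw [Finset.mem_powerset] at hT
        rw [Finset.mem_filter, Finset.mem_powerset]
        refine ⟨Finset.sdiff_subset, fun x hx => Finset.mem_sdiff.2 ⟨hRC hx, fun hxT => ?_⟩⟩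
        exact (Finset.mem_sdiff.1 (hT hxT)).2 hx
      · intro B hB
        rw [Finset.mem_filter, Finset.mem_powerset] at hB
        exact Finset.sdiff_sdiff_eq_self hB.1
      · intro T hT
        rw [Finset.mem_powerset] at hT
        exact Finset.sdiff_sdiff_eq_self (hT.trans Finset.sdiff_subset)
      · intro B hB
        rw [Finset.mem_filter] at hB
        rw [if_pos hB.2, mul_one]
    rw [hstep]
    have hz := Finset.sum_powerset_neg_one_pow_card (x := C \ R)
    have hcast : ∑ T ∈ (C \ R).powerset, (-1 : ℂ) ^ T.card
        = ((∑ T ∈ (C \ R).powerset, (-1 : ℤ) ^ T.card : ℤ) : ℂ) := by push_cast; rfl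
    rw [hcast, hz]
    by_cases h : R = C
    · subst h; simp
    · have hne : C \ R ≠ ∅ := fun h' => h (Finset.Subset.antisymm hRC (Finset.sdiff_eq_empty_iff_subset.1 h'))
      rw [if_neg hne, if_neg h]; simp
  · have h : R ≠ C := fun h => hRC (h ▸ Finset.Subset.rfl)
    rw [if_neg h]
    refine Finset.sum_eq_zero fun B hB => ?_
    rw [if_neg (fun hRB => hRC (hRB.trans (Finset.mem_powerset.1 hB))), mul_zero]

/-- The Möbius transform over the sub-catalogues of the `B`-restricted order-`n` terms is the `C`-supported term
(plumbing: exchange of sums + inclusion–exclusion). [cite: Balaban1988RG2Cluster, (2.13) p.14] (elementary API for (2.13)) -/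
private theorem sum_powerset_ursellTermIn (ζ : P → P → ℝ) (H : P → ℂ) (n : ℕ) (C : Finset P) :
    ∑ B ∈ C.powerset, (-1 : ℂ) ^ (C \ B).card * ursellTermIn ζ H n B = ursellTermOn ζ H n C := by
  unfold ursellTermIn ursellTermOn
  simp_rw [Finset.sum_filter, Finset.mul_sum, Finset.sum_comm (s := C.powerset)]
  refine Finset.sum_congr rfl fun Z _ => ?_
  have hiff : ∀ B : Finset P, (∀ i, Z i ∈ B) ↔ Finset.univ.image Z ⊆ B := fun B => by
    rw [Finset.image_subset_iff]; simp
  have key := sum_powerset_neg_one_pow_sdiff_indicator (Finset.univ.image Z) C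
  calc ∑ B ∈ C.powerset, (-1 : ℂ) ^ (C \ B).card * (if ∀ i, Z i ∈ B then ((rhoT ζ Z : ℝ) : ℂ) * ∏ i, H (Z i) else 0)
      = (∑ B ∈ C.powerset, (-1 : ℂ) ^ (C \ B).card * (if Finset.univ.image Z ⊆ B then 1 else 0))
          * (((rhoT ζ Z : ℝ) : ℂ) * ∏ i, H (Z i)) := by
        rw [Finset.sum_mul]
        refine Finset.sum_congr rfl fun B _ => ?_
        by_cases h : ∀ i, Z i ∈ B
        · rw [if_pos h, if_pos ((hiff B).1 h)]; ring
        · rw [if_neg h, if_neg (fun h' => h ((hiff B).2 h'))]; ring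
    _ = if Finset.univ.image Z = C then ((rhoT ζ Z : ℝ) : ℂ) * ∏ i, H (Z i) else 0 := by
        rw [key]
        split_ifs <;> simp

/-- **THE TERMWISE MAYER IDENTITY of row B13.Def2.12**: the tree's truncated weight `Φ^T(C)` ([KP86, (3)], the
kernel object behind `B13Resummation.locE`) EQUALS the part of the printed series (2.12) carried by the sequences
`(Z₁,…,Z_n)` whose set of members is exactly `C`: `Φ^T(C; H) = Σ_{n≥1} (1/n!) Σ_{(Z₁..Z_n): {Z_i} = C} ρ^T(Z₁..Z_n)
H(Z₁)⋯H(Z_n)`, for `ζ = zetaOf ι` and activities for which (2.12) over `C` converges absolutely with a margin (explicit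
sufficient condition: `summable_ursellAbsTermIn_of_small`, `e·|C|·max_C|H|·r < 1`).  Möbius inversion of
`polymerLogZ_eq_tsum_ursellTermIn` over `B ⊆ C`. [cite: Balaban1988RG2Cluster, (2.12)–(2.13) p.14] -/
theorem truncatedWeight_eq_tsum_ursellTermOn [Std.Refl ι] [Std.Symm ι] (H : P → ℂ) (C : Finset P) {r : ℝ}
    (hr : 1 < r) (hC : Summable fun n => ursellAbsTermIn (zetaOf ι) H (n + 1) C * r ^ n / n.factorial) :
    truncatedWeight ι H C = ∑' n : ℕ, (n.factorial : ℂ)⁻¹ * ursellTermOn (zetaOf ι) H n C := by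
  unfold truncatedWeight
  have hB : ∀ B ∈ C.powerset, (-1 : ℂ) ^ (C \ B).card * polymerLogZ ι H B
      = ∑' n : ℕ, (-1 : ℂ) ^ (C \ B).card * ((n.factorial : ℂ)⁻¹ * ursellTermIn (zetaOf ι) H n B) := by
    intro B hB
    have hBC : B ⊆ C := Finset.mem_powerset.1 hB
    rw [polymerLogZ_eq_tsum_ursellTermIn H B hr
      (Summable.of_nonneg_of_le
        (fun n => div_nonneg (mul_nonneg (ursellAbsTermIn_nonneg _ _ _ _) (pow_nonneg (by linarith) _))
          (Nat.cast_nonneg _))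
        (fun n => by gcongr; exact ursellAbsTermIn_mono _ _ _ hBC) hC), tsum_mul_left]
  rw [Finset.sum_congr rfl hB, ← Summable.tsum_finsetSum (fun B hB =>
    (summable_ursellTermIn (zetaOf ι) H (Finset.mem_powerset.1 hB) hr hC).mul_left _)]
  refine tsum_congr fun n => ?_
  rw [← sum_powerset_ursellTermIn]
  rw [Finset.mul_sum]
  refine Finset.sum_congr rfl fun B _ => ?_
  ring

/-- **(2.13) AS PRINTED = the tree's `B13Resummation.locE`**: for `X` a union of footprints,
`𝐄^{(k+1)}(X) = Σ_{n≥1} (1/n!) Σ_{(Z₁..Z_n): ∪Z_i = X} ρ^T(Z₁..Z_n) H(Z₁)⋯H(Z_n)` (`B13MayerDecoupling.ursellSeries213`)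
EQUALS `Σ_{C: ∪_{Z∈C} cubes Z = X} Φ^T(C)` (`locE ι cubes H X`, the Kotecký–Preiss form used by the kernel route
`B13Resummation` / `B13Closing`), for `ζ = zetaOf ι` and activities for which (2.12) over the polymers inside `X`
converges absolutely with a margin. [cite: Balaban1988RG2Cluster, (2.13) p.14] -/
theorem ursellSeries213_eq_locE [Std.Refl ι] [Std.Symm ι] {Cube : Type*} [DecidableEq Cube] (H : P → ℂ)
    (cubes : P → Finset Cube) (X : Finset Cube) {r : ℝ} (hr : 1 < r)
    (hX : Summable fun n => ursellAbsTermIn (zetaOf ι) H (n + 1)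
      (B13FamilySum.inside Finset.univ cubes X) * r ^ n / n.factorial) :
    ursellSeries213 (zetaOf ι) H cubes X = B13Resummation.locE ι cubes H X := by
  unfold B13Resummation.locE ursellSeries213
  have hsub : ∀ C ∈ B13FamilySum.coveringFamilies Finset.univ cubes X, C ⊆ B13FamilySum.inside Finset.univ cubes X := by
    intro C hC Y hY
    rw [B13FamilySum.mem_coveringFamilies] at hC
    rw [B13FamilySum.mem_inside]
    refine ⟨Finset.mem_univ _, ?_⟩
    rw [← hC.2]
    exact Finset.subset_biUnion_of_mem cubes hY
  have hC : ∀ C ∈ B13FamilySum.coveringFamilies Finset.univ cubes X,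
      truncatedWeight ι H C = ∑' n : ℕ, (n.factorial : ℂ)⁻¹ * ursellTermOn (zetaOf ι) H n C := fun C hC' =>
    truncatedWeight_eq_tsum_ursellTermOn H C hr
      (Summable.of_nonneg_of_le
        (fun n => div_nonneg (mul_nonneg (ursellAbsTermIn_nonneg _ _ _ _) (pow_nonneg (by linarith) _))
          (Nat.cast_nonneg _))
        (fun n => by gcongr; exact ursellAbsTermIn_mono _ _ _ (hsub C hC')) hX)
  rw [Finset.sum_congr rfl hC, ← Summable.tsum_finsetSum (fun C hC' => ?_)]
  · refine tsum_congr fun n => ?_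
    rw [← Finset.mul_sum]
    congr 1
    unfold ursellTermOn B13FamilySum.coveringFamilies
    rw [Finset.sum_fiberwise_eq_sum_filter]
    refine Finset.sum_congr (Finset.filter_congr fun Z _ => ?_) fun _ _ => rfl
    rw [Finset.mem_filter, Finset.mem_powerset, Finset.image_biUnion]
    simp
  · -- summability of each `C`-series
    refine (summable_nat_add_iff 1).1 (Summable.of_norm_bounded hX fun n => ?_)
    rw [norm_mul, norm_inv, Complex.norm_natCast]
    have h1 : ‖ursellTermOn (zetaOf ι) H (n + 1) C‖ ≤ ursellAbsTermIn (zetaOf ι) H (n + 1)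
        (B13FamilySum.inside Finset.univ cubes X) :=
      (norm_ursellTermOn_le _ H (n + 1) C).trans (ursellAbsTermIn_mono _ H (n + 1) (hsub C hC'))
    have h2 : ((n + 1).factorial : ℝ)⁻¹ ≤ (n.factorial : ℝ)⁻¹ := by
      refine inv_anti₀ (by positivity) ?_
      exact_mod_cast Nat.factorial_le (Nat.le_succ n)
    have h3 : (1 : ℝ) ≤ r ^ n := one_le_pow₀ hr.le
    have h4 := ursellAbsTermIn_nonneg (zetaOf ι) H (n + 1) (B13FamilySum.inside Finset.univ cubes X)
    calc (((n + 1).factorial : ℕ) : ℝ)⁻¹ * ‖ursellTermOn (zetaOf ι) H (n + 1) C‖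
        ≤ (n.factorial : ℝ)⁻¹ * (ursellAbsTermIn (zetaOf ι) H (n + 1)
            (B13FamilySum.inside Finset.univ cubes X) * r ^ n) := by
          refine mul_le_mul h2 ?_ (norm_nonneg _) (by positivity)
          calc ‖ursellTermOn (zetaOf ι) H (n + 1) C‖
              ≤ ursellAbsTermIn (zetaOf ι) H (n + 1) (B13FamilySum.inside Finset.univ cubes X) * 1 := by
                rw [mul_one]; exact h1
            _ ≤ _ := by gcongr
      _ = _ := by ring

end Local

/-! ## §6. *"If the activities H(Z) … are sufficiently small"*: an explicit sufficient condition, and the `ζ`-form -/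

section Small

variable [Fintype P] [DecidableEq P]

/-- The number of sequences of length `n` with values in `B` is `|B|^n` (plumbing).
[cite: Balaban1988RG2Cluster, (2.12) p.14] (elementary API for (2.12)) -/
private theorem card_filter_mem (B : Finset P) (n : ℕ) :
    ((Finset.univ : Finset (Fin n → P)).filter (fun Z => ∀ i, Z i ∈ B)).card = B.card ^ n := by
  rw [← map_valComp, Finset.card_map, Finset.card_univ, Fintype.card_fun, Fintype.card_coe, Fintype.card_fin]

/-- **The tree-graph bound summed**: `Σ_{(Z₁..Z_n) ∈ B^n} |ρ^T| Π|H(Z_i)| ≤ |B|^n · n^{n−2} · M^n` for `|H| ≤ M` on `B`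
and `n ≥ 1` (`B13UrsellKP.abs_rhoT_le_pow`). [cite: Balaban1988RG2Cluster, (2.12) p.14] -/
theorem ursellAbsTermIn_le {ζ : P → P → ℝ} (h01 : ∀ Z Z', ζ Z Z' = 0 ∨ ζ Z Z' = 1)
    (hsymm : ∀ Z Z', ζ Z Z' = ζ Z' Z) (H : P → ℂ) {M : ℝ} {B : Finset P}
    (hM : ∀ γ ∈ B, ‖H γ‖ ≤ M) {n : ℕ} (hn : 0 < n) :
    ursellAbsTermIn ζ H n B ≤ (B.card : ℝ) ^ n * ((n : ℝ) ^ (n - 2) * M ^ n) := by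
  unfold ursellAbsTermIn
  have hterm : ∀ Z ∈ (Finset.univ : Finset (Fin n → P)).filter (fun Z => ∀ i, Z i ∈ B),
      |rhoT ζ Z| * ∏ i, ‖H (Z i)‖ ≤ (n : ℝ) ^ (n - 2) * M ^ n := by
    intro Z hZ
    have hZB : ∀ i, Z i ∈ B := (Finset.mem_filter.1 hZ).2
    have hM0 : 0 ≤ M := (norm_nonneg _).trans (hM _ (hZB ⟨0, hn⟩))
    refine mul_le_mul (abs_rhoT_le_pow h01 hsymm hn Z) ?_ (Finset.prod_nonneg fun _ _ => norm_nonneg _)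
      (by positivity)
    calc ∏ i, ‖H (Z i)‖ ≤ ∏ _i : Fin n, M :=
          Finset.prod_le_prod (fun i _ => norm_nonneg _) (fun i _ => hM _ (hZB i))
      _ = M ^ n := by rw [Finset.prod_const, Finset.card_univ, Fintype.card_fin]
  refine (Finset.sum_le_card_nsmul _ _ _ hterm).trans ?_
  rw [nsmul_eq_mul, card_filter_mem]
  push_cast
  exact le_rfl

/-- **An explicit "sufficiently small"**: if `|H(Z)| ≤ M` on `B` and `e·|B|·M·r < 1` then the series (2.12) over the
sequences with values in `B` converges absolutely with the margin `r` — the hypothesis of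
`polymerLogZ_eq_tsum_ursellTermIn` / `truncatedWeight_eq_tsum_ursellTermOn` (with `B = C`) /
`ursellSeries213_eq_locE` (with `B` = the polymers inside `X`) / `ursellSeries212_eq_polymerLogZ` (with `B = univ`).
(From the tree-graph bound and `k^k/k! ≤ e^k`; the paper's own, volume-uniform route to convergence is Lemma 3 + [26],
kernel-certified in Kotecký–Preiss form by `B13Resummation`.) [cite: Balaban1988RG2Cluster, (2.12) p.14] -/
theorem summable_ursellAbsTermIn_of_small {ζ : P → P → ℝ} (h01 : ∀ Z Z', ζ Z Z' = 0 ∨ ζ Z Z' = 1)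
    (hsymm : ∀ Z Z', ζ Z Z' = ζ Z' Z) (H : P → ℂ) {B : Finset P} {M r : ℝ} (hM0 : 0 ≤ M) (hr : 0 ≤ r)
    (hM : ∀ γ ∈ B, ‖H γ‖ ≤ M) (hsmall : Real.exp 1 * B.card * M * r < 1) :
    Summable fun n => ursellAbsTermIn ζ H (n + 1) B * r ^ n / n.factorial := by
  set q : ℝ := Real.exp 1 * B.card * M * r with hq
  have hq0 : 0 ≤ q := by positivity
  have hgeom : Summable fun n : ℕ => (Real.exp 1 * B.card * M) * q ^ n :=
    (summable_geometric_of_lt_one hq0 hsmall).mul_left _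
  refine Summable.of_nonneg_of_le
    (fun n => div_nonneg (mul_nonneg (ursellAbsTermIn_nonneg _ _ _ _) (pow_nonneg hr _)) (Nat.cast_nonneg _))
    (fun n => ?_) hgeom
  have h1 := ursellAbsTermIn_le h01 hsymm H hM (Nat.succ_pos n)
  have hfac : (((n + 1 : ℕ) : ℝ)) ^ (n + 1 - 2) / (n.factorial : ℝ) ≤ Real.exp 1 ^ (n + 1) := by
    have hx := Real.pow_div_factorial_le_exp (((n + 1 : ℕ) : ℝ)) (by positivity) (n + 1)
    rw [Real.exp_one_pow]
    calc (((n + 1 : ℕ) : ℝ)) ^ (n + 1 - 2) / (n.factorial : ℝ)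
        ≤ (((n + 1 : ℕ) : ℝ)) ^ n / (n.factorial : ℝ) := by
          gcongr
          · exact_mod_cast Nat.succ_le_succ (Nat.zero_le n)
          · omega
      _ = (((n + 1 : ℕ) : ℝ)) ^ (n + 1) / ((n + 1).factorial : ℝ) := by
          rw [Nat.factorial_succ, pow_succ]
          push_cast
          have hne : ((n : ℝ) + 1) ≠ 0 := by positivity
          have hne' : (n.factorial : ℝ) ≠ 0 := by positivity
          field_simp
      _ ≤ Real.exp (((n + 1 : ℕ) : ℝ)) := hx
  have hb0 : (0 : ℝ) ≤ B.card := Nat.cast_nonneg _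
  calc ursellAbsTermIn ζ H (n + 1) B * r ^ n / (n.factorial : ℝ)
      ≤ (B.card : ℝ) ^ (n + 1) * ((((n + 1 : ℕ) : ℝ)) ^ (n + 1 - 2) * M ^ (n + 1)) * r ^ n / (n.factorial : ℝ) := by
        gcongr
    _ = ((B.card : ℝ) ^ (n + 1) * M ^ (n + 1) * r ^ n) * ((((n + 1 : ℕ) : ℝ)) ^ (n + 1 - 2) / (n.factorial : ℝ)) := by
        ring
    _ ≤ ((B.card : ℝ) ^ (n + 1) * M ^ (n + 1) * r ^ n) * Real.exp 1 ^ (n + 1) := by gcongr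
    _ = (Real.exp 1 * B.card * M) * q ^ n := by rw [hq]; ring

/-- absolute terms over the whole catalogue are the `univ`-restricted ones (plumbing).
[cite: Balaban1988RG2Cluster, (2.12) p.14] (elementary API for (2.12)) -/
theorem ursellAbsTermIn_univ (ζ : P → P → ℝ) (H : P → ℂ) (n : ℕ) :
    ursellAbsTermIn ζ H n Finset.univ = ursellAbsTerm ζ H n := by
  unfold ursellAbsTermIn ursellAbsTerm
  refine Finset.sum_congr ?_ fun _ _ => rfl
  ext Z
  simp

/-- **(2.12) = `log Ξ` under the explicit smallness `e·|P|·max|H|·r < 1`, `r > 1`** (corollary of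
`ursellSeries212_eq_polymerLogZ` and `summable_ursellAbsTermIn_of_small`). [cite: Balaban1988RG2Cluster, (2.12) p.14] -/
theorem ursellSeries212_eq_polymerLogZ_of_small [Std.Refl ι] [Std.Symm ι] (H : P → ℂ) {M r : ℝ} (hM0 : 0 ≤ M)
    (hr : 1 < r) (hM : ∀ γ, ‖H γ‖ ≤ M) (hsmall : Real.exp 1 * Fintype.card P * M * r < 1) :
    ursellSeries212 (zetaOf ι) H = polymerLogZ ι H Finset.univ := by
  refine ursellSeries212_eq_polymerLogZ H hr ?_
  have h := summable_ursellAbsTermIn_of_small (zetaOf_01 (ι := ι)) zetaOf_symm H (B := Finset.univ) hM0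
    (zero_le_one.trans hr.le) (fun γ _ => hM γ) (by rwa [Finset.card_univ])
  simpa only [ursellAbsTermIn_univ] using h

omit [Fintype P] [DecidableEq P] in
/-- The printed `ζ` of a `{0,1}`-valued two-body function is recovered from its zero set (so every theorem above
applies to r10's `ζ`-language objects with `ι Z Z′ :⟺ ζ(Z, Z′) = 0`). [cite: Balaban1988RG2Cluster, (2.11) p.14] -/
theorem zetaOf_zeroSet {ζ : P → P → ℝ} (h01 : ∀ Z Z', ζ Z Z' = 0 ∨ ζ Z Z' = 1) :
    zetaOf (fun Z Z' => ζ Z Z' = 0) = ζ := by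
  funext Z Z'
  unfold zetaOf
  rcases h01 Z Z' with h | h <;> simp [h]

/-- **(2.12) = `log Ξ`, `ζ`-form**: for any two-body function with the three printed properties (values in `{0,1}`,
symmetric, `ζ(Z,Z) = 0`) the printed series (2.12) sums to the Kotecký–Preiss logarithm of the polymer gas with
incompatibility `ζ(Z, Z′) = 0`, under absolute convergence with a margin. [cite: Balaban1988RG2Cluster, (2.12) p.14] -/
theorem ursellSeries212_eq_polymerLogZ' (ζ : P → P → ℝ) (h01 : ∀ Z Z', ζ Z Z' = 0 ∨ ζ Z Z' = 1)
    (hsymm : ∀ Z Z', ζ Z Z' = ζ Z' Z) (hdiag : ∀ Z, ζ Z Z = 0) (H : P → ℂ) {r : ℝ} (hr : 1 < r)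
    (hU : Summable fun n => ursellAbsTerm ζ H (n + 1) * r ^ n / n.factorial) :
    ursellSeries212 ζ H = polymerLogZ (fun Z Z' => ζ Z Z' = 0) H Finset.univ := by
  haveI : Std.Refl (fun Z Z' => ζ Z Z' = 0) := ⟨hdiag⟩
  haveI : Std.Symm (fun Z Z' => ζ Z Z' = 0) := ⟨fun a b h => (hsymm b a).trans h⟩
  have h := ursellSeries212_eq_polymerLogZ (ι := fun Z Z' => ζ Z Z' = 0) H hr (by rwa [zetaOf_zeroSet h01])
  rwa [zetaOf_zeroSet h01] at h

/-- **(2.13) = `locE`, `ζ`-form**. [cite: Balaban1988RG2Cluster, (2.13) p.14] -/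
theorem ursellSeries213_eq_locE' (ζ : P → P → ℝ) (h01 : ∀ Z Z', ζ Z Z' = 0 ∨ ζ Z Z' = 1)
    (hsymm : ∀ Z Z', ζ Z Z' = ζ Z' Z) (hdiag : ∀ Z, ζ Z Z = 0) {Cube : Type*} [DecidableEq Cube] (H : P → ℂ)
    (cubes : P → Finset Cube) (X : Finset Cube) {r : ℝ} (hr : 1 < r)
    (hX : Summable fun n => ursellAbsTermIn ζ H (n + 1) (B13FamilySum.inside Finset.univ cubes X) * r ^ n
      / n.factorial) :
    ursellSeries213 ζ H cubes X = B13Resummation.locE (fun Z Z' => ζ Z Z' = 0) cubes H X := by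
  haveI : Std.Refl (fun Z Z' => ζ Z Z' = 0) := ⟨hdiag⟩
  haveI : Std.Symm (fun Z Z' => ζ Z Z' = 0) := ⟨fun a b h => (hsymm b a).trans h⟩
  have h := ursellSeries213_eq_locE (ι := fun Z Z' => ζ Z Z' = 0) H cubes X hr (by rwa [zetaOf_zeroSet h01])
  rwa [zetaOf_zeroSet h01] at h

end Small

end Literature.MathematicalPhysics.QuantumFieldTheory.Balaban1983to89.B13UrsellKPSeries
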